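import Literature.NumberTheory.Transcendental.CurvePeriodsEllipticPathsProofs
import HarnessLib

/-!
# Crux `RealOnePeriodRelations` (stmt-KontsevichZagierPeriods-10042), line `nash-retraction-thin-strip`:
# stub `stub_manyPathsCore` — auxiliary file: the family endgame

The endgame of Huber–Wüstholz, Thm. 13.3 (2), for ARBITRARY paths on a finite family of elliptic
curves `E_{L_j}` (`j ∈ J`) together with `𝔾ₘ` and `𝔸¹`, isolated from the tree's one-curve theorem
`CurvePeriods.huberWustholzCurvePeriods_of_ellipticPaths`
(`Literature/NumberTheory/Transcendental/CurvePeriodsEllipticPathsProofs.lean`) and ported to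
several classes of blocks.

* `manyPathsCore_fibre_rel` — an integer relation among the block coordinates
  `(m_l^{(j)})_{(j,l) ∈ Σ j, Fin r_j}` supported on ONE class `i` restricts to an integer relation
  among the `ℤ`-linearly independent `m^{(i)}`, hence is trivial;
* `manyPathsCore_endgame` — given, for every symbol `s` of the support of a combination `c` with
  vanishing period, a normal form
  `s ∼ Σ_j liftPart_j (A_j s) (B_j s) + Σ_i q_{s,i} ℓ_i + e_s 𝟙` modulo the elementary relations
  (basis lifts `D_l^{(j)} : t₀^{(j)} ↝ t₀^{(j)} + m_l^{(j)}` per class, symbols `ℓ_i` — in the application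
  the logarithm symbols `(𝔾ₘ, y dx, E_{0,y_i})` — whose periods `y_i` form a `ℚ`-linearly independent
  family of logarithms of algebraic numbers), the sum over the support is `c − W` with
  `W = Σ_j liftPart_j (A_tot j) (B_tot j) + Σ_i D_i ℓ_i + e_tot 𝟙`; the period of `W` vanishes
  (`Ell.evalCombination_liftPart`), and the ALTERNATIVES at the point
  `u = (1; (y_i); (m_l^{(j)}, ζ_j(t₀^{(j)} + m_l^{(j)}) − ζ_j(t₀^{(j)}))_{j,l})` of
  `G = 𝔾ₐ × 𝔾ₘ^ι × ∏_{(j,l)} E_{L_j}♮` (hypothesis `hALT`, blocks `Σ j, Fin r_j`, classes `Sigma.fst`)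
  — `1 ≠ 0`, no integer relation among the `y_i`, no integer relation among the `m^{(j)}` of one
  class — force all coefficients of `W` to vanish, so `c` itself is in the span.

References: A. Huber, G. Wüstholz, *Transcendence and Linear Relations of 1-Periods*, Cambridge
Tracts in Mathematics 227, CUP 2022, Thm. 13.3 (2), §13.2, Ch. 15, Thm. 6.2. [HuberWustholz2022]
-/

noncomputable section

open scoped BigOperators PeriodPair Topology
open MvPolynomial Set Complex Filter Metric
open Literature.NumberTheory.Transcendental Literature.NumberTheory.Transcendental.CurvePeriods

namespace Summit.KontsevichZagierPeriods.SymplecticScissors.RealOnePeriodRelations.MultiEllLayer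

/-- **An integer relation among the block coordinates supported on one class is trivial**: for
`ℤ`-linearly independent families `m^{(j)} : Fin r_j → ℂ` (`j ∈ J`), an integer vector `a` on
`Σ j, Fin r_j` vanishing off the class `i` with `Σ_b a_b m_b = 0` vanishes (restrict to the fibre
over `i` and use `not_int_rel_of_linearIndependent_int`).
[cite: HuberWustholz2022, Thm 13.3 (2), §13.2, Ch. 15, Thm 6.2] -/
theorem manyPathsCore_fibre_rel {J : Type} [Fintype J] [DecidableEq J] {r : J → ℕ}
    (m : ∀ j, Fin (r j) → ℂ) (hli : ∀ j, LinearIndependent ℤ (m j)) (i : J)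
    (a : (Σ j, Fin (r j)) → ℤ) (ha : a ≠ 0) (hai : ∀ b : Σ j, Fin (r j), Sigma.fst b ≠ i → a b = 0)
    (haz : ∑ b : Σ j, Fin (r j), (a b : ℂ) * m b.1 b.2 = 0) : False := by
  set a' : Fin (r i) → ℤ := fun l => a ⟨i, l⟩ with ha'
  have ha'0 : a' ≠ 0 := by
    intro h
    apply ha
    funext b
    obtain ⟨j, l⟩ := b
    by_cases hji : j = i
    · subst hji
      exact congr_fun h l
    · exact hai ⟨j, l⟩ hji
  have hsum : ∑ b : Σ j, Fin (r j), (a b : ℂ) * m b.1 b.2 = ∑ l, (a' l : ℂ) * m i l := by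
    rw [Fintype.sum_sigma]
    refine Finset.sum_eq_single i (fun j _ hji => ?_) (fun h => (h (Finset.mem_univ i)).elim)
    exact Finset.sum_eq_zero fun l _ => by rw [hai ⟨j, l⟩ hji, Int.cast_zero, zero_mul]
  rw [hsum] at haz
  exact not_int_rel_of_linearIndependent_int (hli i) a' ha'0 haz

/-- **The family endgame** of Huber–Wüstholz 13.3 (2) for arbitrary paths on the curves `E_{L_j}`
(`j ∈ J`) with `𝔾ₘ` and `𝔸¹`: if every symbol `s` of the support of a combination `c` with
algebraic coefficients and vanishing period is, modulo the elementary relations,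
`Σ_j liftPart_j (A_j s) (B_j s) + Σ_i q_{s,i} ℓ_i + e_s 𝟙` with algebraic coefficients — basis
lifts `D_l^{(j)} : t₀^{(j)} ↝ t₀^{(j)} + m_l^{(j)}` with `ℤ`-independent `m^{(j)}` and
`(m_l^{(j)}, ζ_j(t₀^{(j)} + m_l^{(j)}) − ζ_j(t₀^{(j)}))` a `ℚ̄`-point of `E_{L_j}♮`, symbols `ℓ_i` whose
periods `y_i` are `ℚ`-independent with `e^{y_i} ∈ ℚ̄` — then `c` is in the span: the period of
the subtracted normal form `W` vanishes (`Ell.evalCombination_liftPart`),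
and the alternatives `hALT` at `u = (e_tot; (y_i); (m, ζ-differences))` with blocks
`Σ j, Fin r_j` and classes `Sigma.fst` are excluded by `1 ≠ 0`, `not_int_rel_of_linearIndependent`
and `manyPathsCore_fibre_rel`, so all coefficients of `W` vanish.
[cite: HuberWustholz2022, Thm 13.3 (2), §13.2, Ch. 15, Thm 6.2] -/
theorem manyPathsCore_endgame {J : Type} [Fintype J] [DecidableEq J] (L : J → PeriodPair)
    (hL : ∀ j, IsAlgebraic ℚ (L j).g₂ ∧ IsAlgebraic ℚ (L j).g₃)
    (hALT : ∀ (ι B : Type) [Fintype ι] [Fintype B] (cls : B → J) (x : ℂ) (y : ι → ℂ) (z t : B → ℂ),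
      IsAlgebraic ℚ x → (∀ i, IsAlgebraic ℚ (cexp (y i))) →
      (∀ b, (L (cls b)).IsUnivExtAlgPoint (z b) (t b)) →
      ¬ QbarLinearIndependent (lieCoords x y z t) →
      x = 0 ∨ (∃ p : ι → ℤ, p ≠ 0 ∧ ∑ i, (p i : ℂ) * y i = 0) ∨
        ∃ (i : J) (a : B → ℤ), a ≠ 0 ∧ (∀ b, cls b ≠ i → a b = 0) ∧ ∑ b, (a b : ℂ) * z b = 0)
    {r : J → ℕ} {m : ∀ j, Fin (r j) → ℂ} {t₀ : J → ℂ}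
    (DU : ∀ j (l : Fin (r j)), Ell.LiftData (L j) (t₀ j) (t₀ j + m j l))
    (hli : ∀ j, LinearIndependent ℤ (m j))
    (hpts : ∀ j l, (L j).IsUnivExtAlgPoint (m j l)
      ((L j).weierstrassZeta (t₀ j + m j l) - (L j).weierstrassZeta (t₀ j)))
    {ι : Type} [Fintype ι] (y : ι → ℂ) (hliy : LinearIndependent ℚ y)
    (hy : ∀ i, IsAlgebraic ℚ (cexp (y i)))
    (ℓ : ι → PeriodSymbol) (hℓ : ∀ i, (ℓ i).period = y i)
    (c : PeriodSymbol →₀ ℂ) (hc : ∀ s, IsAlgebraic ℚ (c s))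
    (A B : ∀ j, PeriodSymbol → Fin (r j) → ℂ) (q : PeriodSymbol → ι → ℂ) (e : PeriodSymbol → ℂ)
    (hA : ∀ j, ∀ s ∈ c.support, ∀ l, IsAlgebraic ℚ (A j s l))
    (hB : ∀ j, ∀ s ∈ c.support, ∀ l, IsAlgebraic ℚ (B j s l))
    (hq : ∀ s ∈ c.support, ∀ i, IsAlgebraic ℚ (q s i))
    (he : ∀ s ∈ c.support, IsAlgebraic ℚ (e s))
    (hrel : ∀ s ∈ c.support, ∃ (k : ℕ) (ρ : Fin k → (PeriodSymbol →₀ ℂ)) (a : Fin k → ℂ),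
      (∀ l, IsElementaryRelation (ρ l)) ∧ (∀ l, IsAlgebraic ℚ (a l)) ∧
      Finsupp.single s (1 : ℂ) -
        ∑ j, Ell.liftPart (hL j).1 (hL j).2 (DU j) (A j s) (B j s) -
        ∑ i, q s i • Finsupp.single (ℓ i) (1 : ℂ) -
        e s • Finsupp.single PeriodSymbol.unit (1 : ℂ) = ∑ l, a l • ρ l)
    (h0 : evalCombination c = 0) :
    ∃ (k : ℕ) (ρ : Fin k → (PeriodSymbol →₀ ℂ)) (a : Fin k → ℂ),
      (∀ l, IsElementaryRelation (ρ l)) ∧ (∀ l, IsAlgebraic ℚ (a l)) ∧ c = ∑ l, a l • ρ l := by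
  classical
  -- sum over the support
  obtain ⟨k, ρ, cf, hρ, hcf, hmain⟩ := span_finsetSum c.support (fun s => c s •
      (Finsupp.single s (1 : ℂ) -
        ∑ j, Ell.liftPart (hL j).1 (hL j).2 (DU j) (A j s) (B j s) -
        ∑ i, q s i • Finsupp.single (ℓ i) (1 : ℂ) -
        e s • Finsupp.single PeriodSymbol.unit (1 : ℂ)))
    (fun s hs => span_smul (hc s) (hrel s hs))
  -- the subtracted element `W = Σ_j liftPart_j (Atot j) (Btot j) + Σ_i Dg i ℓ_i + etot 𝟙`
  set Atot : ∀ j, Fin (r j) → ℂ := fun j => ∑ s ∈ c.support, c s • A j s with hAtot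
  set Btot : ∀ j, Fin (r j) → ℂ := fun j => ∑ s ∈ c.support, c s • B j s with hBtot
  set Dg : ι → ℂ := fun i => ∑ s ∈ c.support, c s * q s i with hDg
  set etot : ℂ := ∑ s ∈ c.support, c s * e s with hetot
  have hc_eq : c = ∑ s ∈ c.support, c s • Finsupp.single s (1 : ℂ) := by
    conv_lhs => rw [← Finsupp.sum_single c]
    simp only [Finsupp.sum, Finsupp.smul_single_one]
  have hident : ∑ s ∈ c.support, c s • (Finsupp.single s (1 : ℂ) -
        ∑ j, Ell.liftPart (hL j).1 (hL j).2 (DU j) (A j s) (B j s) -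
        ∑ i, q s i • Finsupp.single (ℓ i) (1 : ℂ) -
        e s • Finsupp.single PeriodSymbol.unit (1 : ℂ)) =
      c - (∑ j, Ell.liftPart (hL j).1 (hL j).2 (DU j) (Atot j) (Btot j) +
        ∑ i, Dg i • Finsupp.single (ℓ i) (1 : ℂ) +
        etot • Finsupp.single PeriodSymbol.unit (1 : ℂ)) := by
    have e1 : ∀ s, c s • (Finsupp.single s (1 : ℂ) -
        ∑ j, Ell.liftPart (hL j).1 (hL j).2 (DU j) (A j s) (B j s) -
        ∑ i, q s i • Finsupp.single (ℓ i) (1 : ℂ) -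
        e s • Finsupp.single PeriodSymbol.unit (1 : ℂ)) =
        c s • Finsupp.single s (1 : ℂ) -
          ∑ j, Ell.liftPart (hL j).1 (hL j).2 (DU j) (c s • A j s) (c s • B j s) -
          ∑ i, (c s * q s i) • Finsupp.single (ℓ i) (1 : ℂ) -
          (c s * e s) • Finsupp.single PeriodSymbol.unit (1 : ℂ) := by
      intro s
      simp only [smul_sub, Finset.smul_sum, smul_smul, Ell.smul_liftPart]
    have e2 : ∑ s ∈ c.support, ∑ j, Ell.liftPart (hL j).1 (hL j).2 (DU j) (c s • A j s) (c s • B j s) =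
        ∑ j, Ell.liftPart (hL j).1 (hL j).2 (DU j) (Atot j) (Btot j) := by
      rw [Finset.sum_comm]
      exact Finset.sum_congr rfl fun j _ =>
        Ell.liftPart_finset_sum _ _ _ _ (fun s => c s • A j s) (fun s => c s • B j s)
    have e3 : ∑ s ∈ c.support, ∑ i, (c s * q s i) • Finsupp.single (ℓ i) (1 : ℂ) =
        ∑ i, Dg i • Finsupp.single (ℓ i) (1 : ℂ) := by
      rw [Finset.sum_comm]
      exact Finset.sum_congr rfl fun i _ => by rw [hDg, Finset.sum_smul]
    have e4 : ∑ s ∈ c.support, (c s * e s) • Finsupp.single PeriodSymbol.unit (1 : ℂ) =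
        etot • Finsupp.single PeriodSymbol.unit (1 : ℂ) := by rw [hetot, Finset.sum_smul]
    simp_rw [e1]
    rw [Finset.sum_sub_distrib, Finset.sum_sub_distrib, Finset.sum_sub_distrib, ← hc_eq, e2, e3, e4]
    abel
  rw [hident] at hmain
  -- the period of `W` vanishes
  set tζ : ∀ j, Fin (r j) → ℂ := fun j l =>
    (L j).weierstrassZeta (t₀ j + m j l) - (L j).weierstrassZeta (t₀ j) with htζ
  have hevW : (∑ j, ∑ l, Atot j l * (2 * m j l)) + (∑ j, ∑ l, Btot j l * (-2 * tζ j l)) +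
      (∑ i, Dg i * y i) + etot = 0 := by
    have h1 := evalCombination_eq_zero_of_isElementaryRelation ρ cf hρ
    have h2 : ∀ i, evalCombination (Dg i • Finsupp.single (ℓ i) (1 : ℂ)) =
        Dg i * y i := fun i => by
      rw [evalCombination_smul, evalCombination_single, hℓ i, one_mul]
    have h3 : ∀ j, evalCombination (Ell.liftPart (hL j).1 (hL j).2 (DU j) (Atot j) (Btot j)) =
        (∑ l, Atot j l * (2 * m j l)) + ∑ l, Btot j l * (-2 * tζ j l) := fun j =>
      Ell.evalCombination_liftPart _ _ _ _ _
    rw [← hmain, sub_eq_add_neg, evalCombination_add, h0, zero_add, ← neg_one_smul ℂ,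
      evalCombination_smul, evalCombination_add, evalCombination_add, evalCombination_finsetSum,
      evalCombination_finsetSum, evalCombination_smul, evalCombination_single, period_unit,
      neg_one_mul, neg_eq_zero] at h1
    simp only [h2, h3, Finset.sum_add_distrib, mul_one] at h1
    linear_combination h1
  -- algebraicity of the coefficients
  have hDalg : ∀ i, IsAlgebraic ℚ (Dg i) := fun i =>
    isAlgebraic_finsetSum _ _ fun s hs => (hc s).mul (hq s hs i)
  have hetalg : IsAlgebraic ℚ etot :=
    isAlgebraic_finsetSum _ _ fun s hs => (hc s).mul (he s hs)
  have hAalg : ∀ j l, IsAlgebraic ℚ (Atot j l) := fun j l => by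
    show IsAlgebraic ℚ ((∑ s ∈ c.support, c s • A j s) l)
    rw [Finset.sum_apply]
    exact isAlgebraic_finsetSum _ _ fun s hs => (hc s).mul (hA j s hs l)
  have hBalg : ∀ j l, IsAlgebraic ℚ (Btot j l) := fun j l => by
    show IsAlgebraic ℚ ((∑ s ∈ c.support, c s • B j s) l)
    rw [Finset.sum_apply]
    exact isAlgebraic_finsetSum _ _ fun s hs => (hc s).mul (hB j s hs l)
  -- the alternatives at `u = (1; (y_i); (m_l^{(j)}, ζ_j(t₀^{(j)} + m_l^{(j)}) − ζ_j(t₀^{(j)})))`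
  set zf : (Σ j, Fin (r j)) → ℂ := fun b => m b.1 b.2 with hzf
  set tf : (Σ j, Fin (r j)) → ℂ := fun b => tζ b.1 b.2 with htf
  set γc : Unit ⊕ (ι ⊕ ((Σ j, Fin (r j)) ⊕ (Σ j, Fin (r j)))) → ℂ :=
    lieCoords etot Dg (fun b => 2 * Atot b.1 b.2) (fun b => -2 * Btot b.1 b.2) with hγc
  have hγalg : ∀ x, IsAlgebraic ℚ (γc x) := by
    rintro (_ | i | b | b)
    · exact hetalg
    · exact hDalg i
    · simpa [hγc] using Ell.isAlgebraic_two.mul (hAalg b.1 b.2)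
    · simpa [hγc] using Ell.isAlgebraic_two.neg.mul (hBalg b.1 b.2)
  have hγsum : ∑ x, γc x * lieCoords 1 y zf tf x = 0 := by
    simp only [Fintype.sum_sum_type, Finset.univ_unique, Finset.sum_singleton, hγc, hzf, htf,
      lieCoords_inl, lieCoords_inr_inl, lieCoords_inr_inr_inl, lieCoords_inr_inr_inr,
      Fintype.sum_sigma]
    have e1 : ∑ j, ∑ l, 2 * Atot j l * m j l = ∑ j, ∑ l, Atot j l * (2 * m j l) :=
      Finset.sum_congr rfl fun j _ => Finset.sum_congr rfl fun l _ => by ring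
    have e2 : ∑ j, ∑ l, -2 * Btot j l * tζ j l = ∑ j, ∑ l, Btot j l * (-2 * tζ j l) :=
      Finset.sum_congr rfl fun j _ => Finset.sum_congr rfl fun l _ => by ring
    rw [e1, e2]
    linear_combination hevW
  have hpts' : ∀ b : Σ j, Fin (r j), (L (Sigma.fst b)).IsUnivExtAlgPoint (zf b) (tf b) :=
    fun b => hpts b.1 b.2
  have hzero : ∀ x, γc x = 0 := by
    by_contra hne
    push Not at hne
    obtain ⟨x₀, hx₀⟩ := hne
    have hdep : ¬ QbarLinearIndependent (lieCoords 1 y zf tf) :=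
      fun hQ => hx₀ (hQ γc hγalg hγsum x₀)
    rcases hALT ι (Σ j, Fin (r j)) Sigma.fst 1 y zf tf isAlgebraic_one hy hpts' hdep with
      h0' | ⟨p, hp, hpy⟩ | ⟨i, a, ha, hai, haz⟩
    · exact one_ne_zero h0'
    · exact not_int_rel_of_linearIndependent hliy p hp hpy
    · exact manyPathsCore_fibre_rel m hli i a ha hai (by simpa only [hzf] using haz)
  have het0 : etot = 0 := by simpa [hγc] using hzero (Sum.inl ())
  have hD0 : ∀ i, Dg i = 0 := fun i => by simpa [hγc] using hzero (Sum.inr (Sum.inl i))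
  have hA0 : ∀ j, Atot j = 0 := fun j => funext fun l => by
    have h := hzero (Sum.inr (Sum.inr (Sum.inl ⟨j, l⟩)))
    simpa [hγc] using h
  have hB0 : ∀ j, Btot j = 0 := fun j => funext fun l => by
    have h := hzero (Sum.inr (Sum.inr (Sum.inr ⟨j, l⟩)))
    simpa [hγc] using h
  refine ⟨k, ρ, cf, hρ, hcf, ?_⟩
  rw [← hmain]
  simp [hA0, hB0, Ell.liftPart_zero, hD0, het0]

end Summit.KontsevichZagierPeriods.SymplecticScissors.RealOnePeriodRelations.MultiEllLayer

namespace Summit.KontsevichZagierPeriods.SymplecticScissors.RealOnePeriodRelations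

/-- HELPER ANCHOR of this file (registered on stmt-KontsevichZagierPeriods-10042): an integer relation
among the block coordinates `(m_l^{(j)})` supported on one class is trivial
(`MultiEllLayer.manyPathsCore_fibre_rel`). [cite: HuberWustholz2022, Thm 13.3 (2), §13.2, Ch. 15, Thm 6.2] -/
theorem helper_manyPathsCore_1 : ∀ {J : Type} [Fintype J] [DecidableEq J] {r : J → ℕ} (m : ∀ j, Fin (r j) → ℂ), (∀ j, LinearIndependent ℤ (m j)) → ∀ (i : J) (a : (Σ j, Fin (r j)) → ℤ), a ≠ 0 → (∀ b : Σ j, Fin (r j), Sigma.fst b ≠ i → a b = 0) → ∑ b : Σ j, Fin (r j), (a b : ℂ) * m b.1 b.2 = 0 → False := by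
  intro J _ _ r m hli i a ha hai haz
  exact MultiEllLayer.manyPathsCore_fibre_rel m hli i a ha hai haz

end Summit.KontsevichZagierPeriods.SymplecticScissors.RealOnePeriodRelations

end
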